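import Summits.RiemannHypothesis.RiemannHypothesis.Theorems.WeilFormatCTailJPrelim
import Summits.RiemannHypothesis.RiemannHypothesis.Theorems.WeilFormatCTailMajorant
import Summits.RiemannHypothesis.RiemannHypothesis.Theorems.WeilFormatCSoundness
import HarnessLib

/-!
# Format C, L-C3b at every order (even sector): the order-`J` TAIL majorant `U₂` — polar merged, Hankel form

Route context: Fourier–Galerkin / Schur-complement certificates of Weil positivity on a window ("format C";
cell memo `run/shared/lean/pub/rh-explicit/rh-explicit-weil-10/FORMATC-DESIGN.md` §9.9; supporting
stmt-RiemannHypothesis-0098; seat rh-explicit-weil-10).  For the even SectorSplit kernel `M⁺` of `gramCoeff a` and tail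
modes `m ≥ B₃ ≥ 2B`, the column `b_m(i) = M⁺(i,m)` (block rows `i < B`) splits, by `WeilFormatC.abs_evenKernel_col_sub_sum_le`
and the geometric expansion of the polar factor `c_m = 1/(1+4ω_m²) = Σ_{r<J}(−1)^r q^{r+1}/m^{2r+2} + O(q^{J+1}/m^{2J+2})`
(`q = a²/(4π²)`), into two polynomial families in `1/m` plus a remainder:

`M⁺(i,m) = (−1)^m [ (F_m/π)·Σ_{j<J} v^A_j(i)/m^{2j+1} + Σ_{r<J} v^B_r(i)/m^{2r+2} ] + r_m(i)`, `|r_m(i)| ≤ ρ_i/m^{2J+1}`,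

with `v^A_j(i) = (−1)^i i^{2j}`, `v^B_r(i) = (−1)^i(−i^{2r+1}F_i/π + (4s²/a)(−1)^r q^{r+1} c_i)`,
`ρ_i = 2C_F i^{2J}/π + (4s²/a) q^{J+1} c_i`, `F_n = ½Y_n + P_n − T_n` the mode function of `WeilFormatCColumnKernel`
(`|F_m| ≤ C_A := π/4 + ΛΣ + a(1+E)/(πB₃)` on the tail).  Squaring with Peter–Paul (`θ` for the remainder, `η` between the
two families), summing against weights `1/d_m ≤ 1/d₀`, and bounding the two Gram matrices of inverse powers by
`WeilFormatC.sum_Ico_sq_sum_div_pow_le` (zeta-tail Hankel matrices, closed form, weights `λ_j = B^{e_j}`) gives, for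
EVERY truncation `N`:

* `even_tailJ_majorant` — `Σ_{m∈Ico B₃ N} (Σ_i M⁺(i,m)x_i)²/d_m ≤ (1+θ)(1+η)(C_A²/(π²d₀))·Q_A(α^A) + (1+θ)(1+η⁻¹)(1/d₀)·Q_B(α^B)
  + (1+θ⁻¹)·B·(Σ_iρ_i²x_i²)/(d₀(4J+1)(B₃−1)^{4J+1})`, `α^A_j = Σ_i v^A_j(i)x_i`, `α^B_r = Σ_i v^B_r(i)x_i`, `Q` the explicit
  Hankel quadratic forms.

This is the order-`J` replacement of `WeilFormatC.even_tail_majorant` (order 1): with `B₃ = 2B` the remainder decays like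
`4^{−J}` and no exact column beyond `2B` is needed.  Standard axioms; no definitions; no RH claim.
-/

set_option autoImplicit false
-- `Summit.RiemannHypothesis.RiemannHypothesis.…` is the layout-mandated namespace (summit = problem name).
set_option linter.dupNamespace false

noncomputable section

open Complex Finset Matrix
open scoped Real BigOperators ArithmeticFunction.vonMangoldt

namespace Summit.RiemannHypothesis.RiemannHypothesis.Theorems.WeilFormatC

open Literature.NumberTheory.LFunctions Literature.NumberTheory.LFunctions.Yoshida1992
open Literature.Analysis.SpecialFunctions

variable {a : ℝ}

/-! ## The even column decomposition at order `J` -/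

section Decomp

/-- **Even column decomposition, order `J`.**  For `a > 0`, `1 ≤ m`, `2i ≤ m`:
`|M⁺(i,m) − (−1)^m[(F_m/π)Σ_{j<J}(−1)^i i^{2j}/m^{2j+1} + Σ_{r<J}(−1)^i(−i^{2r+1}F_i/π + (4s²/a)(−1)^r q^{r+1}c_i)/m^{2r+2}]|
 ≤ (2C_F i^{2J}/π + (4s²/a)q^{J+1}c_i)/m^{2J+1}`. -/
theorem abs_evenKernel_col_sub_families_le (ha : 0 < a) {i m : ℕ} (hm : 1 ≤ m) (him : 2 * i ≤ m) (J : ℕ) :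
    |(if i = 0 then gramCoeff a 0 m else if m = 0 then gramCoeff a i 0
        else (gramCoeff a i m + gramCoeff a i (-(m : ℤ))) / 2)
      - (-1 : ℝ) ^ m *
        (((Complex.digamma (1 / 4 + ((freq a m : ℝ) : ℂ) / 2 * I)).im / 2
            + (∑ k ∈ weilPrimeIndex a, (Λ k : ℝ) / Real.sqrt k * Real.sin (freq a m * Real.log k)) - archExpSumSin a m) / π
            * ∑ j ∈ Finset.range J, ((-1 : ℝ) ^ i * (i : ℝ) ^ (2 * j)) / (m : ℝ) ^ (2 * j + 1)
          + ∑ r ∈ Finset.range J, ((-1 : ℝ) ^ i *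
              (-((i : ℝ) ^ (2 * r + 1)) * ((Complex.digamma (1 / 4 + ((freq a i : ℝ) : ℂ) / 2 * I)).im / 2
                  + (∑ k ∈ weilPrimeIndex a, (Λ k : ℝ) / Real.sqrt k * Real.sin (freq a i * Real.log k))
                  - archExpSumSin a i) / π
                + 4 / a * (Real.exp (a / 2) - Real.exp (-(a / 2))) ^ 2 * (-1 : ℝ) ^ r * (a ^ 2 / (4 * π ^ 2)) ^ (r + 1)
                  * (1 / (1 + 4 * freq a i ^ 2)))) / (m : ℝ) ^ (2 * r + 2))|
      ≤ (2 * (π / 4 + (∑ k ∈ weilPrimeIndex a, (Λ k : ℝ) / Real.sqrt k) + a * (1 + weilArchDensity (2 * a)) / π)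
            * (i : ℝ) ^ (2 * J) / π
          + 4 / a * (Real.exp (a / 2) - Real.exp (-(a / 2))) ^ 2 * (a ^ 2 / (4 * π ^ 2)) ^ (J + 1)
            * (1 / (1 + 4 * freq a i ^ 2))) / (m : ℝ) ^ (2 * J + 1) := by
  have hm0 : (0 : ℝ) < m := by exact_mod_cast hm
  have hK := abs_evenKernel_col_sub_sum_le ha hm him J
  have hP := abs_polarFactor_sub_sum_le ha hm J
  -- names
  generalize (if i = 0 then gramCoeff a 0 m else if m = 0 then gramCoeff a i 0
        else (gramCoeff a i m + gramCoeff a i (-(m : ℤ))) / 2) = Mim at hK ⊢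
  generalize (Complex.digamma (1 / 4 + ((freq a m : ℝ) : ℂ) / 2 * I)).im / 2
      + (∑ k ∈ weilPrimeIndex a, (Λ k : ℝ) / Real.sqrt k * Real.sin (freq a m * Real.log k)) - archExpSumSin a m = Fm
    at hK ⊢
  generalize (Complex.digamma (1 / 4 + ((freq a i : ℝ) : ℂ) / 2 * I)).im / 2
      + (∑ k ∈ weilPrimeIndex a, (Λ k : ℝ) / Real.sqrt k * Real.sin (freq a i * Real.log k)) - archExpSumSin a i = Fi
    at hK ⊢
  generalize (π / 4 + (∑ k ∈ weilPrimeIndex a, (Λ k : ℝ) / Real.sqrt k) + a * (1 + weilArchDensity (2 * a)) / π) = CF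
    at hK ⊢
  have hci : 0 < 1 / (1 + 4 * freq a i ^ 2) := by positivity
  have hkP : 0 < 4 / a * (Real.exp (a / 2) - Real.exp (-(a / 2))) ^ 2 := by
    have h1 : Real.exp (-(a / 2)) < Real.exp (a / 2) := Real.exp_lt_exp.mpr (by linarith)
    have h2 : 0 < (Real.exp (a / 2) - Real.exp (-(a / 2))) ^ 2 := by apply pow_pos; linarith
    positivity
  have hq : 0 < a ^ 2 / (4 * π ^ 2) := by positivity
  generalize 1 / (1 + 4 * freq a i ^ 2) = ci at hK hci ⊢
  generalize hcm : 1 / (1 + 4 * freq a m ^ 2) = cm at hK hP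
  generalize 4 / a * (Real.exp (a / 2) - Real.exp (-(a / 2))) ^ 2 = kP at hK hkP ⊢
  generalize a ^ 2 / (4 * π ^ 2) = q at hP hq ⊢
  -- the two main parts differ exactly by the polar expansion error times (−1)^{i+m} kP ci
  set S := ∑ r ∈ Finset.range J, (-1 : ℝ) ^ r * q ^ (r + 1) / (m : ℝ) ^ (2 * r + 2) with hS
  have hsign : (-1 : ℝ) ^ ((i : ℤ) + m) = (-1) ^ i * (-1) ^ m := by
    rw [zpow_add₀ (by norm_num : (-1 : ℝ) ≠ 0), zpow_natCast, zpow_natCast]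
  set SA := ∑ j ∈ Finset.range J, (i : ℝ) ^ (2 * j) / (m : ℝ) ^ (2 * j + 1) with hSA
  set SB := ∑ j ∈ Finset.range J, Fi * (i : ℝ) ^ (2 * j + 1) / (π * (m : ℝ) ^ (2 * j + 2)) with hSB
  have h4 : ∑ j ∈ Finset.range J, (-1 : ℝ) ^ i * (i : ℝ) ^ (2 * j) / (m : ℝ) ^ (2 * j + 1) = (-1 : ℝ) ^ i * SA := by
    rw [hSA, Finset.mul_sum]
    refine Finset.sum_congr rfl fun j _ ↦ by ring
  have h3 : ∑ r ∈ Finset.range J, ((-1 : ℝ) ^ i *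
          (-((i : ℝ) ^ (2 * r + 1)) * Fi / π + kP * (-1 : ℝ) ^ r * q ^ (r + 1) * ci)) / (m : ℝ) ^ (2 * r + 2)
        = (-1 : ℝ) ^ i * (-SB + kP * ci * S) := by
    conv_rhs => rw [hSB, hS, Finset.mul_sum, ← Finset.sum_neg_distrib, ← Finset.sum_add_distrib, Finset.mul_sum]
    refine Finset.sum_congr rfl fun r _ ↦ ?_
    field_simp
  have h5 : ∑ j ∈ Finset.range J, (Fm * (i : ℝ) ^ (2 * j) / (π * (m : ℝ) ^ (2 * j + 1))
          - Fi * (i : ℝ) ^ (2 * j + 1) / (π * (m : ℝ) ^ (2 * j + 2)))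
      = Fm / π * SA - SB := by
    rw [Finset.sum_sub_distrib, hSA, hSB, Finset.mul_sum]
    congr 1
    refine Finset.sum_congr rfl fun j _ ↦ ?_
    field_simp
  have e : Mim - (-1 : ℝ) ^ m *
        (Fm / π * ∑ j ∈ Finset.range J, ((-1 : ℝ) ^ i * (i : ℝ) ^ (2 * j)) / (m : ℝ) ^ (2 * j + 1)
          + ∑ r ∈ Finset.range J, ((-1 : ℝ) ^ i *
              (-((i : ℝ) ^ (2 * r + 1)) * Fi / π + kP * (-1 : ℝ) ^ r * q ^ (r + 1) * ci)) / (m : ℝ) ^ (2 * r + 2))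
      = (Mim - (-1 : ℝ) ^ ((i : ℤ) + m) *
          (kP * ci * cm + ∑ j ∈ Finset.range J, (Fm * (i : ℝ) ^ (2 * j) / (π * (m : ℝ) ^ (2 * j + 1))
            - Fi * (i : ℝ) ^ (2 * j + 1) / (π * (m : ℝ) ^ (2 * j + 2)))))
        + (-1 : ℝ) ^ ((i : ℤ) + m) * kP * ci * (cm - S) := by
    rw [h4, h3, h5, hsign]
    ring
  rw [e]
  have hrem2 : |(-1 : ℝ) ^ ((i : ℤ) + m) * kP * ci * (cm - S)| ≤ kP * q ^ (J + 1) * ci / (m : ℝ) ^ (2 * J + 2) := by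
    rw [abs_mul, abs_mul, abs_mul, abs_neg_one_zpow_natCast_add', one_mul, abs_of_pos hkP, abs_of_pos hci]
    have := mul_le_mul_of_nonneg_left hP (mul_nonneg hkP.le hci.le)
    refine this.trans (le_of_eq ?_)
    ring
  have hrem2' : |(-1 : ℝ) ^ ((i : ℤ) + m) * kP * ci * (cm - S)| ≤ kP * q ^ (J + 1) * ci / (m : ℝ) ^ (2 * J + 1) := by
    refine hrem2.trans ?_
    refine div_le_div_of_nonneg_left (by positivity) (by positivity) ?_
    exact pow_le_pow_right₀ (by exact_mod_cast hm) (by omega)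
  refine (abs_add_le _ _).trans ((add_le_add hK hrem2').trans (le_of_eq ?_))
  ring

end Decomp

/-! ## The order-`J` even tail majorant -/

section Tail

/-- **Even tail majorant, order `J` (functional form).**  For `a > 0`, `1 ≤ B`, `2B ≤ B₃`, `2 ≤ B₃`, tail weights
`0 < d₀ ≤ d_m` (`m ≥ B₃`), `θ, η > 0`, every `N` and every real block vector `x` — see the module docstring. -/
theorem even_tailJ_majorant (ha : 0 < a) {B B₃ : ℕ} (hB : 1 ≤ B) (hBB : 2 * B ≤ B₃) (hB₃ : 2 ≤ B₃) (J : ℕ)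
    (d : ℕ → ℝ) {d₀ : ℝ} (hd₀ : 0 < d₀) (hd : ∀ m, B₃ ≤ m → d₀ ≤ d m) {θ η : ℝ} (hθ : 0 < θ) (hη : 0 < η)
    (N : ℕ) (x : Fin B → ℝ) :
    ∑ m ∈ Finset.Ico B₃ N, (∑ i : Fin B,
        (if (i : ℕ) = 0 then gramCoeff a 0 m else if m = 0 then gramCoeff a i 0
          else (gramCoeff a i m + gramCoeff a i (-(m : ℤ))) / 2) * x i) ^ 2 / d m
      ≤ (1 + θ) * (1 + η) * ((π / 4 + (∑ k ∈ weilPrimeIndex a, (Λ k : ℝ) / Real.sqrt k)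
              + a * (1 + weilArchDensity (2 * a)) / (π * B₃)) ^ 2 / (π ^ 2 * d₀))
          * ((∑ j : Fin J, ∑ j' : Fin J,
                (∑ i : Fin B, (-1 : ℝ) ^ (i : ℕ) * (i : ℝ) ^ (2 * (j : ℕ)) * x i)
                * (∑ i : Fin B, (-1 : ℝ) ^ (i : ℕ) * (i : ℝ) ^ (2 * (j' : ℕ)) * x i)
                * ((1 / (((2 * (j : ℕ) + 1) + (2 * (j' : ℕ) + 1) - 1 : ℕ) * (((B₃ - 1 : ℕ) : ℝ)) ^ ((2 * (j : ℕ) + 1) + (2 * (j' : ℕ) + 1) - 1))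
                    + 1 / (((2 * (j : ℕ) + 1) + (2 * (j' : ℕ) + 1) - 1 : ℕ) * (B₃ : ℝ) ^ ((2 * (j : ℕ) + 1) + (2 * (j' : ℕ) + 1) - 1))) / 2))
              + ∑ j : Fin J, (∑ i : Fin B, (-1 : ℝ) ^ (i : ℕ) * (i : ℝ) ^ (2 * (j : ℕ)) * x i) ^ 2
                * ∑ j' : Fin J,
                  ((1 / (((2 * (j : ℕ) + 1) + (2 * (j' : ℕ) + 1) - 1 : ℕ) * (((B₃ - 1 : ℕ) : ℝ)) ^ ((2 * (j : ℕ) + 1) + (2 * (j' : ℕ) + 1) - 1))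
                    - 1 / (((2 * (j : ℕ) + 1) + (2 * (j' : ℕ) + 1) - 1 : ℕ) * (B₃ : ℝ) ^ ((2 * (j : ℕ) + 1) + (2 * (j' : ℕ) + 1) - 1))) / 2)
                  * (B : ℝ) ^ (2 * (j' : ℕ) + 1) / (B : ℝ) ^ (2 * (j : ℕ) + 1))
        + (1 + θ) * (1 + η⁻¹) * (1 / d₀)
          * ((∑ r : Fin J, ∑ r' : Fin J,
                (∑ i : Fin B, (-1 : ℝ) ^ (i : ℕ) *
                  (-((i : ℝ) ^ (2 * (r : ℕ) + 1)) * ((Complex.digamma (1 / 4 + ((freq a i : ℝ) : ℂ) / 2 * I)).im / 2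
                      + (∑ k ∈ weilPrimeIndex a, (Λ k : ℝ) / Real.sqrt k * Real.sin (freq a i * Real.log k))
                      - archExpSumSin a i) / π
                    + 4 / a * (Real.exp (a / 2) - Real.exp (-(a / 2))) ^ 2 * (-1 : ℝ) ^ (r : ℕ)
                      * (a ^ 2 / (4 * π ^ 2)) ^ ((r : ℕ) + 1) * (1 / (1 + 4 * freq a i ^ 2))) * x i)
                * (∑ i : Fin B, (-1 : ℝ) ^ (i : ℕ) *
                  (-((i : ℝ) ^ (2 * (r' : ℕ) + 1)) * ((Complex.digamma (1 / 4 + ((freq a i : ℝ) : ℂ) / 2 * I)).im / 2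
                      + (∑ k ∈ weilPrimeIndex a, (Λ k : ℝ) / Real.sqrt k * Real.sin (freq a i * Real.log k))
                      - archExpSumSin a i) / π
                    + 4 / a * (Real.exp (a / 2) - Real.exp (-(a / 2))) ^ 2 * (-1 : ℝ) ^ (r' : ℕ)
                      * (a ^ 2 / (4 * π ^ 2)) ^ ((r' : ℕ) + 1) * (1 / (1 + 4 * freq a i ^ 2))) * x i)
                * ((1 / (((2 * (r : ℕ) + 2) + (2 * (r' : ℕ) + 2) - 1 : ℕ) * (((B₃ - 1 : ℕ) : ℝ)) ^ ((2 * (r : ℕ) + 2) + (2 * (r' : ℕ) + 2) - 1))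
                    + 1 / (((2 * (r : ℕ) + 2) + (2 * (r' : ℕ) + 2) - 1 : ℕ) * (B₃ : ℝ) ^ ((2 * (r : ℕ) + 2) + (2 * (r' : ℕ) + 2) - 1))) / 2))
              + ∑ r : Fin J, (∑ i : Fin B, (-1 : ℝ) ^ (i : ℕ) *
                  (-((i : ℝ) ^ (2 * (r : ℕ) + 1)) * ((Complex.digamma (1 / 4 + ((freq a i : ℝ) : ℂ) / 2 * I)).im / 2
                      + (∑ k ∈ weilPrimeIndex a, (Λ k : ℝ) / Real.sqrt k * Real.sin (freq a i * Real.log k))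
                      - archExpSumSin a i) / π
                    + 4 / a * (Real.exp (a / 2) - Real.exp (-(a / 2))) ^ 2 * (-1 : ℝ) ^ (r : ℕ)
                      * (a ^ 2 / (4 * π ^ 2)) ^ ((r : ℕ) + 1) * (1 / (1 + 4 * freq a i ^ 2))) * x i) ^ 2
                * ∑ r' : Fin J,
                  ((1 / (((2 * (r : ℕ) + 2) + (2 * (r' : ℕ) + 2) - 1 : ℕ) * (((B₃ - 1 : ℕ) : ℝ)) ^ ((2 * (r : ℕ) + 2) + (2 * (r' : ℕ) + 2) - 1))
                    - 1 / (((2 * (r : ℕ) + 2) + (2 * (r' : ℕ) + 2) - 1 : ℕ) * (B₃ : ℝ) ^ ((2 * (r : ℕ) + 2) + (2 * (r' : ℕ) + 2) - 1))) / 2)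
                  * (B : ℝ) ^ (2 * (r' : ℕ) + 2) / (B : ℝ) ^ (2 * (r : ℕ) + 2))
        + (1 + θ⁻¹) * ((B : ℝ) / (d₀ * ((4 * J + 1 : ℕ) * (((B₃ - 1 : ℕ) : ℝ)) ^ (4 * J + 1))))
          * ∑ i : Fin B, ((2 * (π / 4 + (∑ k ∈ weilPrimeIndex a, (Λ k : ℝ) / Real.sqrt k)
                + a * (1 + weilArchDensity (2 * a)) / π) * (i : ℝ) ^ (2 * J) / π
              + 4 / a * (Real.exp (a / 2) - Real.exp (-(a / 2))) ^ 2 * (a ^ 2 / (4 * π ^ 2)) ^ (J + 1)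
                * (1 / (1 + 4 * freq a i ^ 2))) ^ 2 * x i ^ 2) := by
  -- abbreviations
  set T := Finset.Ico B₃ N with hT
  have hB₃1 : 1 ≤ B₃ := by omega
  have hB0 : (0 : ℝ) < B := by exact_mod_cast hB
  set CA : ℝ := π / 4 + (∑ k ∈ weilPrimeIndex a, (Λ k : ℝ) / Real.sqrt k)
      + a * (1 + weilArchDensity (2 * a)) / (π * B₃) with hCA
  set Fmode : ℕ → ℝ := fun n ↦ (Complex.digamma (1 / 4 + ((freq a n : ℝ) : ℂ) / 2 * I)).im / 2
      + (∑ k ∈ weilPrimeIndex a, (Λ k : ℝ) / Real.sqrt k * Real.sin (freq a n * Real.log k)) - archExpSumSin a n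
    with hFmode
  set kP : ℝ := 4 / a * (Real.exp (a / 2) - Real.exp (-(a / 2))) ^ 2 with hkP
  set q : ℝ := a ^ 2 / (4 * π ^ 2) with hq
  set cfac : ℕ → ℝ := fun n ↦ 1 / (1 + 4 * freq a n ^ 2) with hcfac
  -- row functionals
  set vA : Fin J → Fin B → ℝ := fun j i ↦ (-1 : ℝ) ^ (i : ℕ) * (i : ℝ) ^ (2 * (j : ℕ)) with hvA
  set vB : Fin J → Fin B → ℝ := fun r i ↦ (-1 : ℝ) ^ (i : ℕ) *
      (-((i : ℝ) ^ (2 * (r : ℕ) + 1)) * Fmode i / π + kP * (-1 : ℝ) ^ (r : ℕ) * q ^ ((r : ℕ) + 1) * cfac i) with hvB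
  set αA : Fin J → ℝ := fun j ↦ ∑ i, vA j i * x i with hαA
  set αB : Fin J → ℝ := fun r ↦ ∑ i, vB r i * x i with hαB
  set ρ : Fin B → ℝ := fun i ↦ (2 * (π / 4 + (∑ k ∈ weilPrimeIndex a, (Λ k : ℝ) / Real.sqrt k)
        + a * (1 + weilArchDensity (2 * a)) / π) * (i : ℝ) ^ (2 * J) / π + kP * q ^ (J + 1) * cfac i) with hρ
  set bcol : ℕ → Fin B → ℝ := fun m i ↦
    (if (i : ℕ) = 0 then gramCoeff a 0 m else if m = 0 then gramCoeff a i 0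
      else (gramCoeff a i m + gramCoeff a i (-(m : ℤ))) / 2) with hbcol
  -- per-mode facts
  have hTm : ∀ m ∈ T, B₃ ≤ m := fun m hm ↦ (Finset.mem_Ico.mp hm).1
  have key : ∀ m ∈ T, (∑ i, bcol m i * x i) ^ 2 / d m
      ≤ (1 + θ) * (1 + η) * (CA ^ 2 / (π ^ 2 * d₀)) * (∑ j, αA j / (m : ℝ) ^ (2 * (j : ℕ) + 1)) ^ 2
        + (1 + θ) * (1 + η⁻¹) * (1 / d₀) * (∑ r, αB r / (m : ℝ) ^ (2 * (r : ℕ) + 2)) ^ 2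
        + (1 + θ⁻¹) * ((B : ℝ) / d₀) * (∑ i, ρ i ^ 2 * x i ^ 2) * (1 / ((m : ℝ) ^ (2 * J + 1)) ^ 2) := by
    intro m hm
    have hmB := hTm m hm
    have hm1 : 1 ≤ m := le_trans hB₃1 hmB
    have hm0 : (0 : ℝ) < m := by exact_mod_cast hm1
    have hdm : d₀ ≤ d m := hd m hmB
    have hdpos : 0 < d m := lt_of_lt_of_le hd₀ hdm
    -- decomposition of the column sum
    set R : ℝ := ∑ i, (bcol m i - (-1 : ℝ) ^ m *
        (Fmode m / π * ∑ j ∈ Finset.range J, ((-1 : ℝ) ^ (i : ℕ) * (i : ℝ) ^ (2 * j)) / (m : ℝ) ^ (2 * j + 1)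
          + ∑ r ∈ Finset.range J, ((-1 : ℝ) ^ (i : ℕ) *
              (-((i : ℝ) ^ (2 * r + 1)) * Fmode i / π + kP * (-1 : ℝ) ^ r * q ^ (r + 1) * cfac i)) / (m : ℝ) ^ (2 * r + 2)))
        * x i with hR
    have hsplit : ∑ i, bcol m i * x i = (-1 : ℝ) ^ m * (Fmode m / π * (∑ j, αA j / (m : ℝ) ^ (2 * (j : ℕ) + 1)) + (∑ r, αB r / (m : ℝ) ^ (2 * (r : ℕ) + 2))) + R := by
      have ePA : (∑ j, αA j / (m : ℝ) ^ (2 * (j : ℕ) + 1)) = ∑ i : Fin B, (∑ j ∈ Finset.range J, ((-1 : ℝ) ^ (i : ℕ) * (i : ℝ) ^ (2 * j)) / (m : ℝ) ^ (2 * j + 1)) * x i := by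
        simp only [hαA, hvA, Finset.sum_div]
        rw [Finset.sum_comm]
        refine Finset.sum_congr rfl fun i _ ↦ ?_
        rw [Finset.sum_mul, Finset.sum_range]
        refine Finset.sum_congr rfl fun j _ ↦ by ring
      have ePB : (∑ r, αB r / (m : ℝ) ^ (2 * (r : ℕ) + 2)) = ∑ i : Fin B, (∑ r ∈ Finset.range J, ((-1 : ℝ) ^ (i : ℕ) *
          (-((i : ℝ) ^ (2 * r + 1)) * Fmode i / π + kP * (-1 : ℝ) ^ r * q ^ (r + 1) * cfac i)) / (m : ℝ) ^ (2 * r + 2)) * x i := by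
        simp only [hαB, hvB, Finset.sum_div]
        rw [Finset.sum_comm]
        refine Finset.sum_congr rfl fun i _ ↦ ?_
        rw [Finset.sum_mul, Finset.sum_range]
        refine Finset.sum_congr rfl fun r _ ↦ by ring
      rw [ePA, ePB, hR, Finset.mul_sum, mul_add, Finset.mul_sum, Finset.mul_sum, ← Finset.sum_add_distrib,
        ← Finset.sum_add_distrib]
      refine Finset.sum_congr rfl fun i _ ↦ by ring
    have hRle : |R| ≤ ∑ i, ρ i / (m : ℝ) ^ (2 * J + 1) * |x i| := by
      refine (Finset.abs_sum_le_sum_abs _ _).trans (Finset.sum_le_sum fun i _ ↦ ?_)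
      rw [abs_mul]
      refine mul_le_mul_of_nonneg_right ?_ (abs_nonneg _)
      have him : 2 * (i : ℕ) ≤ m := by have := i.isLt; omega
      have h := abs_evenKernel_col_sub_families_le ha hm1 him J
      simp only [hbcol, hFmode, hkP, hq, hcfac, hρ]
      exact h
    have hRsq : R ^ 2 ≤ (B : ℝ) * (∑ i, ρ i ^ 2 * x i ^ 2) * (1 / ((m : ℝ) ^ (2 * J + 1)) ^ 2) := by
      have h := sq_sum_mul_le_card_mul (ι := Fin B)
        (fun i ↦ (bcol m i - (-1 : ℝ) ^ m *
          (Fmode m / π * ∑ j ∈ Finset.range J, ((-1 : ℝ) ^ (i : ℕ) * (i : ℝ) ^ (2 * j)) / (m : ℝ) ^ (2 * j + 1)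
            + ∑ r ∈ Finset.range J, ((-1 : ℝ) ^ (i : ℕ) *
                (-((i : ℝ) ^ (2 * r + 1)) * Fmode i / π + kP * (-1 : ℝ) ^ r * q ^ (r + 1) * cfac i)) / (m : ℝ) ^ (2 * r + 2))))
        (fun i ↦ ρ i / (m : ℝ) ^ (2 * J + 1)) x (fun i ↦ by
          have him : 2 * (i : ℕ) ≤ m := by have := i.isLt; omega
          have h := abs_evenKernel_col_sub_families_le ha hm1 him J
          simp only [hbcol, hFmode, hkP, hq, hcfac, hρ]
          exact h)
      simp only [Fintype.card_fin] at h
      refine h.trans (le_of_eq ?_)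
      rw [mul_assoc, Finset.sum_mul]
      congr 1
      refine Finset.sum_congr rfl fun i _ ↦ ?_
      rw [div_pow]
      ring
    -- the structured part
    have hFm : |Fmode m| ≤ CA := by
      simp only [hFmode, hCA]
      exact abs_modeF_le_far ha hB₃1 hmB
    have hmain : (Fmode m / π * (∑ j, αA j / (m : ℝ) ^ (2 * (j : ℕ) + 1)) + (∑ r, αB r / (m : ℝ) ^ (2 * (r : ℕ) + 2))) ^ 2
        ≤ (1 + η) * (CA ^ 2 / π ^ 2) * (∑ j, αA j / (m : ℝ) ^ (2 * (j : ℕ) + 1)) ^ 2 + (1 + η⁻¹) * (∑ r, αB r / (m : ℝ) ^ (2 * (r : ℕ) + 2)) ^ 2 := by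
      have hpp := sq_add_le_peterPaul (p := Fmode m / π * (∑ j, αA j / (m : ℝ) ^ (2 * (j : ℕ) + 1))) (q := (∑ r, αB r / (m : ℝ) ^ (2 * (r : ℕ) + 2))) hη
      have hF2 : (Fmode m / π * (∑ j, αA j / (m : ℝ) ^ (2 * (j : ℕ) + 1))) ^ 2 ≤ CA ^ 2 / π ^ 2 * (∑ j, αA j / (m : ℝ) ^ (2 * (j : ℕ) + 1)) ^ 2 := by
        rw [mul_pow, div_pow]
        refine mul_le_mul_of_nonneg_right ?_ (sq_nonneg _)
        refine div_le_div_of_nonneg_right ?_ (by positivity)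
        have hCA0 : 0 ≤ CA := (abs_nonneg _).trans hFm
        calc Fmode m ^ 2 = |Fmode m| ^ 2 := (sq_abs _).symm
          _ ≤ CA ^ 2 := pow_le_pow_left₀ (abs_nonneg _) hFm 2
      have h1 : 0 ≤ 1 + η := by positivity
      refine hpp.trans ((add_le_add (mul_le_mul_of_nonneg_left hF2 h1) le_rfl).trans (le_of_eq ?_))
      ring
    -- assemble: square, Peter–Paul in θ, divide by d m ≥ d₀
    have hsq : (∑ i, bcol m i * x i) ^ 2
        ≤ (1 + θ) * ((1 + η) * (CA ^ 2 / π ^ 2) * (∑ j, αA j / (m : ℝ) ^ (2 * (j : ℕ) + 1)) ^ 2 + (1 + η⁻¹) * (∑ r, αB r / (m : ℝ) ^ (2 * (r : ℕ) + 2)) ^ 2)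
          + (1 + θ⁻¹) * ((B : ℝ) * (∑ i, ρ i ^ 2 * x i ^ 2) * (1 / ((m : ℝ) ^ (2 * J + 1)) ^ 2)) := by
      rw [hsplit]
      have hpp := sq_add_le_peterPaul (p := (-1 : ℝ) ^ m * (Fmode m / π * (∑ j, αA j / (m : ℝ) ^ (2 * (j : ℕ) + 1)) + (∑ r, αB r / (m : ℝ) ^ (2 * (r : ℕ) + 2)))) (q := R) hθ
      have hsgn : ((-1 : ℝ) ^ m * (Fmode m / π * (∑ j, αA j / (m : ℝ) ^ (2 * (j : ℕ) + 1)) + (∑ r, αB r / (m : ℝ) ^ (2 * (r : ℕ) + 2)))) ^ 2 = (Fmode m / π * (∑ j, αA j / (m : ℝ) ^ (2 * (j : ℕ) + 1)) + (∑ r, αB r / (m : ℝ) ^ (2 * (r : ℕ) + 2))) ^ 2 := by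
        rw [mul_pow, ← pow_mul, Even.neg_one_pow (by exact ⟨m, by ring⟩), one_mul]
      rw [hsgn] at hpp
      have h1 : 0 ≤ 1 + θ := by positivity
      have h2 : 0 ≤ 1 + θ⁻¹ := by positivity
      exact hpp.trans (add_le_add (mul_le_mul_of_nonneg_left hmain h1) (mul_le_mul_of_nonneg_left hRsq h2))
    have hnn : 0 ≤ (1 + θ) * ((1 + η) * (CA ^ 2 / π ^ 2) * (∑ j, αA j / (m : ℝ) ^ (2 * (j : ℕ) + 1)) ^ 2 + (1 + η⁻¹) * (∑ r, αB r / (m : ℝ) ^ (2 * (r : ℕ) + 2)) ^ 2)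
          + (1 + θ⁻¹) * ((B : ℝ) * (∑ i, ρ i ^ 2 * x i ^ 2) * (1 / ((m : ℝ) ^ (2 * J + 1)) ^ 2)) := by
      have : 0 ≤ ∑ i, ρ i ^ 2 * x i ^ 2 := Finset.sum_nonneg fun i _ ↦ by positivity
      positivity
    calc (∑ i, bcol m i * x i) ^ 2 / d m
        ≤ ((1 + θ) * ((1 + η) * (CA ^ 2 / π ^ 2) * (∑ j, αA j / (m : ℝ) ^ (2 * (j : ℕ) + 1)) ^ 2 + (1 + η⁻¹) * (∑ r, αB r / (m : ℝ) ^ (2 * (r : ℕ) + 2)) ^ 2)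
          + (1 + θ⁻¹) * ((B : ℝ) * (∑ i, ρ i ^ 2 * x i ^ 2) * (1 / ((m : ℝ) ^ (2 * J + 1)) ^ 2))) / d m :=
          div_le_div_of_nonneg_right hsq hdpos.le
      _ ≤ ((1 + θ) * ((1 + η) * (CA ^ 2 / π ^ 2) * (∑ j, αA j / (m : ℝ) ^ (2 * (j : ℕ) + 1)) ^ 2 + (1 + η⁻¹) * (∑ r, αB r / (m : ℝ) ^ (2 * (r : ℕ) + 2)) ^ 2)
          + (1 + θ⁻¹) * ((B : ℝ) * (∑ i, ρ i ^ 2 * x i ^ 2) * (1 / ((m : ℝ) ^ (2 * J + 1)) ^ 2))) / d₀ :=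
          div_le_div_of_nonneg_left hnn hd₀ hdm
      _ = _ := by
          field_simp
  -- sum over the tail and apply the Hankel bounds
  have hsumA := sum_Ico_sq_sum_div_pow_le (D := J) (fun j ↦ 2 * (j : ℕ) + 1) (fun j ↦ by omega) hB₃
    (fun j ↦ (B : ℝ) ^ (2 * (j : ℕ) + 1)) (fun j ↦ by positivity) N αA
  have hsumB := sum_Ico_sq_sum_div_pow_le (D := J) (fun r ↦ 2 * (r : ℕ) + 2) (fun r ↦ by omega) hB₃
    (fun r ↦ (B : ℝ) ^ (2 * (r : ℕ) + 2)) (fun r ↦ by positivity) N αB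
  have hsumR := sum_Ico_one_div_pow_two_mul_le (E := 2 * J + 1) (by omega) hB₃ N
  have h4J : 2 * (2 * J + 1) - 1 = 4 * J + 1 := by omega
  rw [h4J] at hsumR
  -- the three coefficient signs
  have hcA : 0 ≤ (1 + θ) * (1 + η) * (CA ^ 2 / (π ^ 2 * d₀)) := by positivity
  have hcB : 0 ≤ (1 + θ) * (1 + η⁻¹) * (1 / d₀) := by positivity
  have hcR : 0 ≤ (1 + θ⁻¹) * ((B : ℝ) / d₀) * (∑ i, ρ i ^ 2 * x i ^ 2) := by
    have : 0 ≤ ∑ i, ρ i ^ 2 * x i ^ 2 := Finset.sum_nonneg fun i _ ↦ by positivity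
    positivity
  have hR' : ∑ m ∈ T, 1 / ((m : ℝ) ^ (2 * J + 1)) ^ 2
      ≤ 1 / ((4 * J + 1 : ℕ) * (((B₃ - 1 : ℕ) : ℝ)) ^ (4 * J + 1)) := hsumR
  have step1 : ∑ m ∈ T, (∑ i, bcol m i * x i) ^ 2 / d m
      ≤ (1 + θ) * (1 + η) * (CA ^ 2 / (π ^ 2 * d₀)) * ∑ m ∈ T, (∑ j, αA j / (m : ℝ) ^ (2 * (j : ℕ) + 1)) ^ 2
          + (1 + θ) * (1 + η⁻¹) * (1 / d₀) * ∑ m ∈ T, (∑ r, αB r / (m : ℝ) ^ (2 * (r : ℕ) + 2)) ^ 2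
          + (1 + θ⁻¹) * ((B : ℝ) / d₀) * (∑ i, ρ i ^ 2 * x i ^ 2) * ∑ m ∈ T, (1 / ((m : ℝ) ^ (2 * J + 1)) ^ 2) := by
    refine (Finset.sum_le_sum key).trans (le_of_eq ?_)
    simp only [Finset.sum_add_distrib, ← Finset.mul_sum]
  have step2 := add_le_add (add_le_add (mul_le_mul_of_nonneg_left hsumA hcA) (mul_le_mul_of_nonneg_left hsumB hcB))
    (mul_le_mul_of_nonneg_left hR' hcR)
  refine (step1.trans step2).trans (le_of_eq ?_)
  simp only [hαA, hαB, hvA, hvB, hρ, hCA, hFmode, hkP, hq, hcfac]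
  ring

end Tail

end Summit.RiemannHypothesis.RiemannHypothesis.Theorems.WeilFormatC

end
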